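/-
Copyright (c) 2026 the pub-hodgecm-mathlib formalisation cell (harness21).  Typist seat hodgecm-mathlib-R90-C11-typ1 (g4), R90-TF section S2 «Ch11-arch»
(S2 dealer K2E1b-plan (g8), DESK WORDS ×6 2026-09-05T02:47:25Z item (3): «then FREE → next by name: the OF-LETTERS TIES … SIG-first, one file per socket»):
the OF-LETTERS TIE for socket σ14 (KT3): the archimedean endoscopic-transfer law of the `H`-kit of record ON PATH (`X := HInfExt.xiRows L ι μω`, canonical factor) at the families `(mHi, mGi)` FROM the `∀`-closure of letter ℓ6.
-/
import Summits.HodgeConjecture.HodgeConjecture.Theorems.R90S2InnerTransferLawLettersDefs   -- ★ the KT-side letters ℓ5 ∕ ℓ6 ∕ ℓ7 (R90-C11-typ1 (g4), filed by K2-defs1 (g8)): `InnerTransferCharLetter`, `EndoCharXiLetter`, `StableVirtualCharLetter` + their `_iff`s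
import HarnessLib

/-!
# R90 ∕ S2 «Ch11-arch», OF-LETTERS TIE (T14) for socket σ14 `stub_R90_S2_KT3` —
# `R90_S2_KT3_of_letters : (∀ p q κ, EndoCharXiLetter L ι H T hT νGi νHi μω mHi mGi p q κ) → (rogawskiArchKitH L ι H μω (xiRows μω)).EndoTransferLawTest L H Δ‴_∞ mHi mGi (archTrHOfRecord L ι νHi (xiRows μω)) (archTr₀ L ι H T hT νGi)`

Cell `pub/hodgecm-mathlib` (D-0151), crux H413 = `stmt-HodgeConjecture-24833` (`--supports … --as helper`; closes nothing by itself).  ONE theorem, no definition ∕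
instance ∕ notation ∕ named fact ∕ `sorry`; sole project import = ★ `R90S2InnerTransferLawLettersDefs` (LAW L9 ∕ S2-R10′: no `Cruxes/…/Lines` import — the orbital families
`mHi` on `H_∞ = U(Φ₂)_∞ × U(Φ₁)_∞` and `mGi` on `G′_∞ = U(H)_∞` are PARAMETERS here, in ℓ6's binder bytes; the Lines edition instantiates them at a `ComparisonKit`'s
`(𝔨.mHi, 𝔨.mGi)` under `𝔨.ArchCoherence hanis νGi νqi νHi`).
THE TIE (ExportA, next edition, socket σ14 `stub_R90_S2_KT3` :258–:284, statement FROZEN): after `intro hanis 𝔨 hcoh` the goal is LITERALLY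
`(rogawskiArchKitH L ι H μω (HInfExt.xiRows L ι μω)).EndoTransferLawTest L H (archCanonicalTransferFactor L H μω) 𝔨.mHi 𝔨.mGi (archTrHOfRecord L ι νHi (HInfExt.xiRows L ι μω))
(UnitaryGroup.archTr₀ L ι H T hT νGi)`, closed by `exact R90_S2_KT3_of_letters L ι H T hT νGi νHi μω 𝔨.mHi 𝔨.mGi ‹the ℓ6 instances at 𝔨, from the edition's letter-stub›`
(junction certified in the socket's own frame: typ1 (g4) scratch `JUNCTION-L567.v0.lean` 01215cf9e76d3eff, J-L6a∕b).  The proof is modus ponens on ★ `endoCharXiLetter_iff`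
(proved there: on a character packet `(xi p q, κ)` the kit's endoscopic packet trace is the single-token trace ★ `ArchPacketKitH.trPktInfH_of_isCharPacketInf` ∘ ★
`isCharPacketInf_xi`; on an extension label the law is vacuous on path, ★ `HInfExt.xiRows_lawKT3`).  Print: Prop. 12.3.3 (a) p. 178 (`Tr ξ(f^H) = Tr πⁿ(ξ)(f) + Tr πˢ(ξ)(f)`
at the place of `ι`), Prop. 14.4.2 (c) p. 236 (sign `−1` at the compact places), assembled over `∞` as on p. 243 l. 9–17 for `f^H_∞` a `Δ‴_∞`-transfer of `f′_∞` (§14.3 p. 234)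
[Shelstad1983].
HONEST LABEL: HC_CM is proved only modulo the 7 printed citations (2 remaining named inputs: hLiu418 = stmt-HodgeConjecture-24832, h413 =
stmt-HodgeConjecture-24833) until rung 0 closes; this file proves ONE implication of an `Iff` already in the tree — it discharges no socket by itself (the
letter instances it consumes are typed debt stated by the Lines edition), establishes no character identity, and leaves the code-`sorry` count of record unchanged.

## References
* [Rogawski1990] J. Rogawski, *Automorphic Representations of Unitary Groups in Three Variables*, Annals of Math. Studies 123 (1990), §12.3 Prop. 12.3.3 (a) p. 178; §14.3 p. 234;
  §14.4 Prop. 14.4.2 (c) p. 236; §14.6 p. 243.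
* [Shelstad1983] D. Shelstad, *Orbital integrals, endoscopic groups and `L`-indistinguishability for real groups*, Journées Automorphes, Publ. Math. Univ. Paris VII 15 (1983), main theorem.
* [Shelstad1979] D. Shelstad, *Characters and inner forms of a quasi-split group over `ℝ`*, Compositio Math. 39 (1979), Introduction.
-/

set_option autoImplicit false
set_option linter.dupNamespace false

noncomputable section

open MeasureTheory MeasureTheory.Measure NumberField IsDedekindDomain
open scoped Matrix MatrixGroups Classical

namespace Summit.HodgeConjecture.HodgeConjecture.R90.S2

open Literature.NumberTheory Literature.NumberTheory.Automorphic Literature.NumberTheory.Automorphic.UnitaryGroup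
open Literature.NumberTheory.Rogawski1990 Literature.NumberTheory.GaloisRepresentations
open Literature.RepresentationTheory
open Literature.RepresentationTheory.KonnoKonno2007 Literature.RepresentationTheory.KonnoKonno2007.RealDualPair
open Literature.RepresentationTheory.KonnoKonno2007.RealDualPair.UForm
open Summit.HodgeConjecture.HodgeConjecture.Cruxes.H413
open Summit.HodgeConjecture.HodgeConjecture.Cruxes.H413.F0P3InnerFormClassificationV6 (Gp Places Cinf)
open Summit.HodgeConjecture.HodgeConjecture.Cruxes.H413.F0P3XiArchPacketOfRecord (archPacketAt archPacketAt_πn_of_not)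
open Summit.HodgeConjecture.HodgeConjecture.Cruxes.H413.F0P3ArchPacketKit
open Summit.HodgeConjecture.HodgeConjecture.Cruxes.H413.K2E1bCarriersOfRecord (jInfOfRecord dsInfOfRecord)

/-- **(T14) σ14 FROM THE LETTERS ℓ6** — for the inner form `U(H)` (ball frame `T, hT`), the measures `νGi` on `G′_∞`, `νHi` on `H_∞`, the Hecke character `μω` (the
`H`-kit of record ON PATH is `rogawskiArchKitH L ι H μω (HInfExt.xiRows L ι μω)`) and the orbital families `(mHi, mGi)`: if letter ℓ6 holds at EVERY character packet
`ξ_ι(p,q) ⊗ κ` (★ `EndoCharXiLetter`: `Tr (ξ_ι(p,q) ⊗ κ)_∞(a^H) = Σ_{c ∈ Π(ξ_H)} ⟨ξ, c⟩ Θ′_c(f′_∞)` for every `C_c^∞` pair `(a^H, f′_∞)` related by ★ `IsArchDeltaTransfer`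
for the canonical factor ★ `archCanonicalTransferFactor L H μω`), then the `H`-kit passes the archimedean endoscopic-transfer law test ★ `EndoTransferLawTest` at `(mHi, mGi)`
against `archTrHOfRecord L ι νHi (xiRows μω)` and `archTr₀ L ι H T hT νGi` — σ14's goal after `intro hanis 𝔨 hcoh`, at `mHi := 𝔨.mHi`, `mGi := 𝔨.mGi`.  Modus ponens on ★
`endoCharXiLetter_iff`. [cite: Rogawski1990, §12.3 Prop. 12.3.3 (a) p. 178; §14.4 Prop. 14.4.2 (c) p. 236; §14.6 p. 243 l. 9–17; §14.3 p. 234] [cite: Shelstad1983, main theorem] -/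
theorem R90_S2_KT3_of_letters (L : Type) [Field L] [NumberField L] [IsCMField L] (ι : L →+* ℂ) (H : Matrix (Fin 3) (Fin 3) L) (T : GL (Fin 3) ℂ)
    (hT : (T : Matrix (Fin 3) (Fin 3) ℂ)ᴴ * H.map ι * (T : Matrix (Fin 3) (Fin 3) ℂ) = Literature.Geometry.ComplexHyperbolic.BallModel.J)
    (νGi : @Measure (UnitaryGroup.arch (↥(maximalRealSubfield L)) L (IsCMField.complexConj L) 3 H) (borel _))
    (νHi : @Measure (UnitaryGroup.arch (↥(maximalRealSubfield L)) L (IsCMField.complexConj L) 2 (F0P3InnerFormClassificationV6.splitForm L 2) ×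
      UnitaryGroup.arch (↥(maximalRealSubfield L)) L (IsCMField.complexConj L) 1 (F0P3InnerFormClassificationV6.splitForm L 1)) (borel _))
    (μω : HeckeCharacter L)
    (mHi : letI : ∀ a : UnitaryGroup.arch (↥(maximalRealSubfield L)) L (IsCMField.complexConj L) 2 (F0P3InnerFormClassificationV6.splitForm L 2) × UnitaryGroup.arch (↥(maximalRealSubfield L)) L (IsCMField.complexConj L) 1 (F0P3InnerFormClassificationV6.splitForm L 1), MeasurableSpace ((UnitaryGroup.arch (↥(maximalRealSubfield L)) L (IsCMField.complexConj L) 2 (F0P3InnerFormClassificationV6.splitForm L 2) × UnitaryGroup.arch (↥(maximalRealSubfield L)) L (IsCMField.complexConj L) 1 (F0P3InnerFormClassificationV6.splitForm L 1)) ⧸ Subgroup.centralizer ({a} : Set (UnitaryGroup.arch (↥(maximalRealSubfield L)) L (IsCMField.complexConj L) 2 (F0P3InnerFormClassificationV6.splitForm L 2) × UnitaryGroup.arch (↥(maximalRealSubfield L)) L (IsCMField.complexConj L) 1 (F0P3InnerFormClassificationV6.splitForm L 1)))) := fun _ => borel _;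
      OrbitalMeasureFamily (UnitaryGroup.arch (↥(maximalRealSubfield L)) L (IsCMField.complexConj L) 2 (F0P3InnerFormClassificationV6.splitForm L 2) × UnitaryGroup.arch (↥(maximalRealSubfield L)) L (IsCMField.complexConj L) 1 (F0P3InnerFormClassificationV6.splitForm L 1)))
    (mGi : letI : ∀ γ : UnitaryGroup.arch (↥(maximalRealSubfield L)) L (IsCMField.complexConj L) 3 H, MeasurableSpace (UnitaryGroup.arch (↥(maximalRealSubfield L)) L (IsCMField.complexConj L) 3 H ⧸ Subgroup.centralizer ({γ} : Set (UnitaryGroup.arch (↥(maximalRealSubfield L)) L (IsCMField.complexConj L) 3 H))) := fun _ => borel _;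
      OrbitalMeasureFamily (UnitaryGroup.arch (↥(maximalRealSubfield L)) L (IsCMField.complexConj L) 3 H))
    (hℓ6 : ∀ (p q : ℤ) (κ : {κ : CptPlace L ι → ℤ × ℤ // ∀ w, κ w ∈ (HInfExt.xiRows L ι μω).cptLab w}), EndoCharXiLetter L ι H T hT νGi νHi μω mHi mGi p q κ) :
    (rogawskiArchKitH L ι H μω (HInfExt.xiRows L ι μω)).EndoTransferLawTest L H (archCanonicalTransferFactor L H μω) mHi mGi
      (archTrHOfRecord L ι νHi (HInfExt.xiRows L ι μω)) (UnitaryGroup.archTr₀ L ι H T hT νGi) :=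
  (endoCharXiLetter_iff L ι H T hT νGi νHi μω mHi mGi).1 hℓ6

end Summit.HodgeConjecture.HodgeConjecture.R90.S2

end
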